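import Summits.AtomisticToContinuum.BoseEinsteinCondensation.Theorems.BECGroundStateSOSBoundaryTransferWeakHardWallLimitCutoffEnergy
import Literature.MathematicalPhysics.QuantumManyBody.BoseGasDirichletWall

/-!
# Route `BECGroundStateSOS`, crux `BoundaryTransferWeak` (stmt-AtomisticToContinuum-0827),
# line `rim-squeeze-monotone-coherence`, stub (L): the rim-layer cutoff, III (the cut-off state)

Supports (does not close) stmt-AtomisticToContinuum-0827; auxiliary block of the registered stub
`stub_hardWallLimit` (L) (lead c3), sequel of `…HardWallLimitCutoffNorm.lean` and
`…HardWallLimitCutoffEnergy.lean`. The cut-off `F(X) = Ψ(X - 2h𝟙) ∏_{i,k} q(x_{ik})` of a periodic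
trial state `Ψ` of the torus of side `L` with rim mass `m < 1` is normalised into an admissible
DIRICHLET trial state `Φ = F/‖F‖` of the fattened cube of side `L/2 + 4h` (`C¹`, supported in the
open box, Bose-symmetric), with

* `energy v Φ ≤ (1 - m)⁻¹ ((1+η) periodicEnergy v Ψ + (1+η⁻¹) D² · 3m)` for EVERY pair potential `v`
  and every Young parameter `η > 0`;
* `∫ |Φ - 1_cell Ψ(· - 2h𝟙)|² ≤ 4m` (`2∫|F/‖F‖ - F|² + 2∫|F - 1_cell Ψ(·-2h𝟙)|²`, both `≤ 2m`:
  `(‖F‖⁻¹ - 1)² ‖F‖² = (1 - ‖F‖)² ≤ (1 - ‖F‖²)² ≤ m`).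

This is `exists_cutoffTrialState` (anchor `stub_hardWallLimit_cutoffState`): the `v`-independent
half of the near-minimiser transfer across the hard wall, to which
`…HardWallLimitAux.lean` reduced stub (L). For a `δ`-near-minimiser of `H_t` the rim mass is
`≤ (E_t + δ)/t`, so every cost here is `O(1/(t h²))`. What it leaves: the `2h`-translation (an
`L²`-modulus of continuity, `O(h² N · kinetic energy)`) and the shrink of the fattened cube back to
side `L/2`. All `[folklore]`.
-/

noncomputable section

namespace Summit.AtomisticToContinuum.BoseEinsteinCondensation.RimSqueeze

open Literature.MathematicalPhysics.QuantumManyBody.BoseGas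
open MeasureTheory Filter Set
open scoped ENNReal NNReal ComplexConjugate

variable {N : ℕ} {L h D : ℝ} {q : ℝ → ℝ}

/-! ### The normalised cut-off state -/

/-- **The rim-layer cut-off state.** For a periodic trial state `Ψ` with rim mass `m < 1`, the
normalised cut-off `F/‖F‖` is an admissible Dirichlet trial state of the fattened cube of side
`L/2 + 4h` with
`energy ≤ (1 - m)⁻¹ ((1+η) periodicEnergy v Ψ + (1+η⁻¹) D² 3m)` (every pair potential `v`) and
`∫ |Φ - 1_cell Ψ(· - 2h𝟙)|² ≤ 4m`. [folklore] -/
theorem exists_cutoffTrialState (hL : 0 < L) (hh : 0 < h) (h8 : 8 * h < L)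
    (hq : IsCutoffProfile q (h / 2) (L / 2 + 3 * h) D) (v : ℝ → ℝ≥0∞) (Ψ : PeriodicTrialState N L)
    (hm : ∫⁻ Y in cellN N L, (∑ j, rimPot L (Y j)) * (‖Ψ.ψ Y‖₊ : ℝ≥0∞) ^ 2 < 1) {η : ℝ}
    (hη : 0 < η) :
    ∃ Φ : TrialState N (L / 2 + 4 * h),
      energy v Φ ≤ (1 - ∫⁻ Y in cellN N L, (∑ j, rimPot L (Y j)) * (‖Ψ.ψ Y‖₊ : ℝ≥0∞) ^ 2)⁻¹ *
        ((1 + ENNReal.ofReal η) * periodicEnergy v Ψ +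
          (1 + ENNReal.ofReal η⁻¹) * ENNReal.ofReal (D ^ 2) *
            (3 * ∫⁻ Y in cellN N L, (∑ j, rimPot L (Y j)) * (‖Ψ.ψ Y‖₊ : ℝ≥0∞) ^ 2)) ∧
      ∫⁻ X, (‖Φ.ψ X - (cellN N L).indicator (fun X => Ψ.ψ (X + fun _ =>
        (WithLp.toLp 2 fun _ : Fin 3 => -(2 * h) : Space))) X‖₊ : ℝ≥0∞) ^ 2 ≤
        4 * ∫⁻ Y in cellN N L, (∑ j, rimPot L (Y j)) * (‖Ψ.ψ Y‖₊ : ℝ≥0∞) ^ 2 := by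
  set u : Space := WithLp.toLp 2 fun _ : Fin 3 => -(2 * h) with hu
  set U : Config N := fun _ => u with hU
  set F : Config N → ℂ := fun X => Ψ.ψ (X + U) * ((∏ p : Fin N × Fin 3, q (X p.1 p.2) : ℝ) : ℂ)
    with hF
  set G : Config N → ℂ := (cellN N L).indicator (fun X => Ψ.ψ (X + U)) with hG
  set m : ℝ≥0∞ := ∫⁻ Y in cellN N L, (∑ j, rimPot L (Y j)) * (‖Ψ.ψ Y‖₊ : ℝ≥0∞) ^ 2 with hm_def
  set A : ℝ≥0∞ := ∫⁻ X, (‖F X‖₊ : ℝ≥0∞) ^ 2 with hA_def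
  have hA1 : A ≤ 1 := lintegral_cutoff_sq_le_one hL h8 hq Ψ u
  have hmA : 1 - m ≤ A := one_sub_rimMass_le_lintegral_cutoff_sq hh h8 hq Ψ
  have hmtop : m ≠ ⊤ := (hm.trans ENNReal.one_lt_top).ne
  have h1m : 0 < 1 - m := tsub_pos_iff_lt.2 hm
  have hA0 : A ≠ 0 := (h1m.trans_le hmA).ne'
  have hAtop : A ≠ ⊤ := ne_top_of_le_ne_top ENNReal.one_ne_top hA1
  -- the normalisation constant `c = ‖F‖⁻¹`
  set a : ℝ := A.toReal with ha_def
  have ha0 : 0 < a := ENNReal.toReal_pos hA0 hAtop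
  have ha1 : a ≤ 1 := by
    have := ENNReal.toReal_mono ENNReal.one_ne_top hA1
    rwa [ENNReal.toReal_one] at this
  have hAa : A = ENNReal.ofReal a := (ENNReal.ofReal_toReal hAtop).symm
  set s : ℝ := Real.sqrt a with hs_def
  have hs0 : 0 < s := Real.sqrt_pos.2 ha0
  have hs2 : s ^ 2 = a := Real.sq_sqrt ha0.le
  have hs1 : s ≤ 1 := by nlinarith
  set c : ℝ := s⁻¹ with hc_def
  have hc0 : 0 ≤ c := by positivity
  have hc1 : 1 ≤ c := one_le_inv_iff₀.2 ⟨hs0, hs1⟩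
  have hc2 : ENNReal.ofReal (c ^ 2) = A⁻¹ := by
    rw [hc_def, inv_pow, hs2, ENNReal.ofReal_inv_of_pos ha0, ← hAa]
  have hFcd : ContDiff ℝ 1 F := contDiff_cutoffState hq.contDiff Ψ.contDiff U
  have hsupp : ∀ t, q t ≠ 0 → t ∈ Ioo 0 (L / 2 + 4 * h) := fun t ht => by
    have := hq.support t ht
    convert this using 2
    ring
  -- the trial state
  let Φ : TrialState N (L / 2 + 4 * h) :=
    { ψ := fun X => (c : ℂ) * F X
      contDiff := contDiff_const.mul hFcd
      eq_zero := fun X hX => by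
        have hF0 : F X = 0 := by
          by_contra hne
          refine hX (mem_boxN_of_prodCutoff_ne_zero hsupp fun h0 => hne ?_)
          show Ψ.ψ (X + U) * ((∏ p : Fin N × Fin 3, q (X p.1 p.2) : ℝ) : ℂ) = 0
          rw [h0, Complex.ofReal_zero, mul_zero]
        show (c : ℂ) * F X = 0
        rw [hF0, mul_zero]
      symm := fun σ X => by
        show (c : ℂ) * F (X ∘ σ) = (c : ℂ) * F X
        rw [show F (X ∘ σ) = F X from cutoffState_comp_perm Ψ.symm u σ X]
      norm_eq := by
        show ∫⁻ X, (‖(c : ℂ) * F X‖₊ : ℝ≥0∞) ^ 2 = 1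
        simp only [ennorm_real_mul_sq c hc0]
        rw [lintegral_const_mul' _ _ ENNReal.ofReal_ne_top, hc2, ENNReal.inv_mul_cancel hA0 hAtop] }
  refine ⟨Φ, ?_, ?_⟩
  · -- the energy
    have hE : energy v Φ = ENNReal.ofReal (c ^ 2) *
        ((∫⁻ X, kineticDensity F X) + ∫⁻ X, interaction v X * (‖F X‖₊ : ℝ≥0∞) ^ 2) := by
      unfold energy
      rw [← lintegral_add_left (measurable_kineticDensity hFcd),
        ← lintegral_const_mul' _ _ ENNReal.ofReal_ne_top]
      refine lintegral_congr fun X => ?_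
      show kineticDensity (fun X => (c : ℂ) * F X) X +
          interaction v X * (‖(c : ℂ) * F X‖₊ : ℝ≥0∞) ^ 2 = _
      rw [kineticDensity_const_mul hFcd c hc0, ennorm_real_mul_sq c hc0]
      ring
    rw [hE, hc2]
    exact mul_le_mul' (ENNReal.inv_le_inv.2 hmA) (lintegral_form_cutoff_le hL hh h8 hq v Ψ hη)
  · -- the `L²` distance to the cell cut-off of the shifted state
    have hFm : Measurable F := hFcd.continuous.measurable
    have h1 : ∫⁻ X, (‖(c : ℂ) * F X - F X‖₊ : ℝ≥0∞) ^ 2 ≤ m := by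
      have e : ∀ X, (c : ℂ) * F X - F X = ((c - 1 : ℝ) : ℂ) * F X := fun X => by
        push_cast
        ring
      have hc1' : 0 ≤ c - 1 := by linarith
      simp only [e, ennorm_real_mul_sq (c - 1) hc1']
      rw [lintegral_const_mul' _ _ ENNReal.ofReal_ne_top, ← hA_def, hAa,
        ← ENNReal.ofReal_mul (sq_nonneg _), ← ENNReal.ofReal_toReal hmtop]
      refine ENNReal.ofReal_le_ofReal ?_
      have hma : 1 - m.toReal ≤ a := by
        have h' := ENNReal.toReal_mono hAtop hmA
        rwa [ENNReal.toReal_sub_of_le hm.le ENNReal.one_ne_top, ENNReal.toReal_one] at h'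
      have hid : (c - 1) ^ 2 * a = (1 - s) ^ 2 := by
        rw [hc_def, ← hs2]
        field_simp
      rw [hid]
      nlinarith [mul_le_mul_of_nonneg_left hs1 hs0.le]
    have h2 : ∫⁻ X, (‖F X - G X‖₊ : ℝ≥0∞) ^ 2 ≤ m := by
      have hsum := lintegral_cutoff_sub_sq_add_le hL h8 hq Ψ u
      have hx : ∫⁻ X, (‖F X - G X‖₊ : ℝ≥0∞) ^ 2 ≤ 1 - A :=
        ENNReal.le_sub_of_add_le_right hAtop hsum
      exact hx.trans ((tsub_le_tsub_left hmA 1).trans tsub_tsub_le)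
    have hpt : ∀ X, (‖(c : ℂ) * F X - G X‖₊ : ℝ≥0∞) ^ 2 ≤
        2 * (‖(c : ℂ) * F X - F X‖₊ : ℝ≥0∞) ^ 2 + 2 * (‖F X - G X‖₊ : ℝ≥0∞) ^ 2 := by
      intro X
      have := ennnorm_sq_le_two_mul ((c : ℂ) * F X - G X) (F X - G X)
      rwa [sub_sub_sub_cancel_right] at this
    have hmeas : Measurable fun X => 2 * (‖(c : ℂ) * F X - F X‖₊ : ℝ≥0∞) ^ 2 :=
      (((measurable_const.mul hFm).sub hFm).nnnorm.coe_nnreal_ennreal.pow_const 2).const_mul 2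
    calc ∫⁻ X, (‖Φ.ψ X - G X‖₊ : ℝ≥0∞) ^ 2
        ≤ ∫⁻ X, 2 * (‖(c : ℂ) * F X - F X‖₊ : ℝ≥0∞) ^ 2 + 2 * (‖F X - G X‖₊ : ℝ≥0∞) ^ 2 :=
          lintegral_mono hpt
      _ = 2 * (∫⁻ X, (‖(c : ℂ) * F X - F X‖₊ : ℝ≥0∞) ^ 2) + 2 * ∫⁻ X, (‖F X - G X‖₊ : ℝ≥0∞) ^ 2 := by
          rw [lintegral_add_left hmeas, lintegral_const_mul' _ _ (by norm_num),
            lintegral_const_mul' _ _ (by norm_num)]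
      _ ≤ 2 * m + 2 * m := add_le_add (mul_le_mul_right h1 2) (mul_le_mul_right h2 2)
      _ = 4 * m := by ring

/-- **Anchor of this block** (quantified form of `exists_cutoffTrialState`). [folklore] -/
theorem stub_hardWallLimit_cutoffState : ∀ {N : ℕ} {L h D : ℝ} {q : ℝ → ℝ}, 0 < L → 0 < h → 8 * h < L → IsCutoffProfile q (h / 2) (L / 2 + 3 * h) D → ∀ (v : ℝ → ℝ≥0∞) (Ψ : PeriodicTrialState N L), ∫⁻ Y in cellN N L, (∑ j, rimPot L (Y j)) * (‖Ψ.ψ Y‖₊ : ℝ≥0∞) ^ 2 < 1 → ∀ η : ℝ, 0 < η → ∃ Φ : TrialState N (L / 2 + 4 * h), energy v Φ ≤ (1 - ∫⁻ Y in cellN N L, (∑ j, rimPot L (Y j)) * (‖Ψ.ψ Y‖₊ : ℝ≥0∞) ^ 2)⁻¹ * ((1 + ENNReal.ofReal η) * periodicEnergy v Ψ + (1 + ENNReal.ofReal η⁻¹) * ENNReal.ofReal (D ^ 2) * (3 * ∫⁻ Y in cellN N L, (∑ j, rimPot L (Y j)) * (‖Ψ.ψ Y‖₊ : ℝ≥0∞)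 ^ 2)) ∧ ∫⁻ X : Config N, (‖Φ.ψ X - (cellN N L).indicator (fun X => Ψ.ψ (X + fun _ => (WithLp.toLp 2 fun _ : Fin 3 => -(2 * h) : Space))) X‖₊ : ℝ≥0∞) ^ 2 ≤ 4 * ∫⁻ Y in cellN N L, (∑ j, rimPot L (Y j)) * (‖Ψ.ψ Y‖₊ : ℝ≥0∞) ^ 2 :=
  fun hL hh h8 hq v Ψ hm _ hη => exists_cutoffTrialState hL hh h8 hq v Ψ hm hη

end Summit.AtomisticToContinuum.BoseEinsteinCondensation.RimSqueeze

end
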